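import Summits.FinalStateConjecture.FinalStateConjecture.Theorems.GapExhaustion.Negative.GapExhaustionFalseOfFarWildBlackHole
import Literature.Geometry.Lorentzian.BondiBartnikGap
import Literature.Geometry.Lorentzian.NearKerrCollarCore
import Literature.Geometry.Lorentzian.CollarMargin
import Literature.Geometry.Lorentzian.HawkingMassFlux
import Literature.Geometry.Lorentzian.TrappedSurface

/-!
# Crux `GapExhaustion` (stmt-FinalStateConjecture-10808) — line `omega-limit-gap-readout`: NO SKELETON (certificate) + the re-typed first lemma

Crux-plan seat `planner-cruxplan-stmt-FinalStateConjecture-10808-omega-limit-gap-read-0`, 2026-08-16.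
Companion of `Lines/omega-limit-gap-readout.md`. **This file is NOT a registrable line**: it contains no
`GapExhaustion_of` and no `stub_*`, on purpose.

* §0 `no_composition_mod_farWild` — the kernel form of the no-skeleton verdict: since
  `FarWildBlackHoleExists → ¬ GapExhaustion` is landed (p108531), EVERY stub set composing to the filed decl is
  false modulo `FarWildBlackHoleExists`; for this idea the dying stub is the late-configuration producer (the
  `k = 3` instance is `Sketch.stub_lateCollaredLeaves`, p115847).
* §1 the idea's first lemma RE-TYPED as the triage panel demanded (`FarConeTightnessPinned`: pinned
  constant-mass-aspect foliation anchored at the outer collar sphere, the foliation's own mass limit, windowed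
  `δ`-collar, honest flat end with profile, one-hole census hypothesis, `N = 1` only) together with the small
  notions it needs (`IsThickCollarChartR`, `HasHonestFlatEnd` copied from `RESTATED_c4.lean` — crux workfiles are
  not importable — `OneHoleBeyond`, `IsPinnedConeFoliation`) and the near/far glue `ownEnergy_le_of_near_far`
  (proved). These are the typed inputs of the far-share line against the RESTATED crux (`GapExhaustionC4`), to be
  turned into `stub_*` + `…C4_of` by the crux-plan seat that runs after the tenure restatement.

`lean check`: rc 0, 0 sorries, 0 warnings (farm, 2026-08-16); only `def`s and four small proved lemmas.
-/

noncomputable section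

-- D-0017: single-problem summit, `Summit.<S>.<S>.…` by design (cf. lakefile `weak.linter.dupNamespace`).
set_option linter.dupNamespace false

namespace Summit.FinalStateConjecture.FinalStateConjecture.Cruxes.GapExhaustion.OmegaLimitGapReadout

open Literature.Geometry.Lorentzian
open Set Filter Topology
open scoped Manifold ContDiff Topology ENNReal

/-! ## §0 No composition to the filed decl survives `FarWildBlackHoleExists` -/

/-- **No-skeleton certificate.** Whatever proposition `S` (read: the conjunction of a line's stubs) implies
the FILED `GapExhaustion`, `S` is false modulo `FarWildBlackHoleExists` — because the filed decl itself is
(`Theorems.GapExhaustion.Negative.GapExhaustion_false_of_farWildBlackHoleExists`, p108531). Hence no line to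
the filed text has all stubs plausibly true; the idea is a line only against the restated crux. [folklore] -/
theorem no_composition_mod_farWild {S : Prop}
    (h : S → Theses.BartnikGapSettling.GapExhaustion) :
    Theorems.GapExhaustion.Negative.FarWildBlackHoleExists → ¬ S :=
  fun H hS => Theorems.GapExhaustion.Negative.GapExhaustion_false_of_farWildBlackHoleExists H (h hS)

/-- The same for a curried two-stub line (the shape `stub₁ → stub₂ → GapExhaustion` of a skeleton's
`GapExhaustion_of`): at least one of the two stubs is false modulo `FarWildBlackHoleExists`. [folklore] -/
theorem no_two_stub_composition_mod_farWild {S₁ S₂ : Prop}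
    (h : S₁ → S₂ → Theses.BartnikGapSettling.GapExhaustion)
    (H : Theorems.GapExhaustion.Negative.FarWildBlackHoleExists) : ¬ S₁ ∨ ¬ S₂ := by
  by_cases h₁ : S₁
  · exact Or.inr fun h₂ =>
      Theorems.GapExhaustion.Negative.GapExhaustion_false_of_farWildBlackHoleExists H (h h₁ h₂)
  · exact Or.inl h₁

/-! ## §1 Typed inputs of the far-share line against the restated crux -/

section Spacetime

variable (𝓢 : Spacetime.{0} 4)

/-- **Thick collar chart block at order `k`, tolerance `δ`, OUT TO RADIUS `R`** — the filed chart block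
(clauses (C1)–(C3) of `NearKerrCollarCore`; `RESTATED_c4.IsThickCollarChart` is the case `R = 3M`) with the slab
radius as a parameter: `B` is the boosted Kerr-star background of label `(M, a)` and motion `mo`, `Φ` is smooth on
and an open embedding of the layer `{−1 < t* < 1, r < R + 1}`, and the `Cᵏ` deviation of `Φ^* g` from boosted
Kerr on `{t* = 0, r ≤ R}` is `≤ δ`. The annulus stub of the line needs `R ≫ 3M`. -/
def IsThickCollarChartR (k : ℕ) (δ : ℝ≥0∞) (R M a : ℝ) (mo : lorentzGroup × E4)
    (B : ModelBackground) (Φ : B.domain → 𝓢.carrier) : Prop :=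
  B = starBackground mo.1 mo.2 M a (fun x => Kerr.radius a (poincareInv mo.1 mo.2 x)) ∧
  ContMDiffOn 𝓘(ℝ, E4) (𝓡 4) ∞ Φ
      {x | -1 < B.time x.1 ∧ B.time x.1 < 1 ∧ B.radius x.1 < R + 1} ∧
  IsOpenEmbedding
      ({x | -1 < B.time x.1 ∧ B.time x.1 < 1 ∧ B.radius x.1 < R + 1}.restrict Φ) ∧
  𝓢.truncDeviationCk B Φ k R 0 ≤ δ

end Spacetime

section Development

variable {X : Type} [TopologicalSpace X] [ChartedSpace E3 X] [IsManifold (𝓡 3) ∞ X]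
  [ConnectedSpace X] {D : InitialDataSet (𝓡 3) X}

/-- **Honest asymptotically flat end through `S` at order `k` with profile `prof`** — verbatim
`RESTATED_c4.HasHonestFlatEnd` (AUDIT-c4 F1 repair; copied because crux workfiles are not importable): a
hyperboloidal flat chart whose domain contains the exterior `{t₀ > −1, |x̲| ≥ R₀}` of the layer, smooth and an open
embedding of the layer into `J⁺(ι X)`, leaf image inside `S`, and `Cᵏ` deviation from `η` on `{t₀ = 0, |x̲| ≥ R}`
at most `prof R` for every `R`. In the far-share line it bounds the static shear offset of the far tail
(TRIAGE-r1-3). -/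
def HasHonestFlatEnd (𝒟 : VacuumCauchyDevelopment D) (k : ℕ) (S : Set 𝒟.carrier)
    (prof : ℝ → ℝ≥0∞) : Prop :=
  ∃ (R₀ : ℝ) (U₀ : TopologicalSpace.Opens E4) (Ψ₀ : (hypBackground U₀).domain → 𝒟.carrier),
    {x : E4 | -1 < x 0 - Real.sqrt (1 + E4.spatialNorm x ^ 2) ∧ R₀ ≤ E4.spatialNorm x} ⊆
        (U₀ : Set E4) ∧
    ContMDiffOn 𝓘(ℝ, E4) (𝓡 4) ∞ Ψ₀
        {x | -1 < (hypBackground U₀).time x.1 ∧ (hypBackground U₀).time x.1 < 1} ∧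
    IsOpenEmbedding
        ({x | -1 < (hypBackground U₀).time x.1 ∧ (hypBackground U₀).time x.1 < 1}.restrict Ψ₀) ∧
    Ψ₀ '' {x | -1 < (hypBackground U₀).time x.1 ∧ (hypBackground U₀).time x.1 < 1} ⊆
        𝒟.metric.causalFuture 𝒟.timeOrientation (range 𝒟.embed) ∧
    Ψ₀ '' (hypBackground U₀).timeSlab 0 ⊆ S ∧
    ∀ R : ℝ, supCkENorm
        (Subtype.val '' {x | x ∈ (hypBackground U₀).timeSlab 0 ∧ R ≤ E4.spatialNorm x.1}) k
        (𝒟.toSpacetime.deviationExtend (hypBackground U₀) Ψ₀) ≤ prof R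

/-- **One-hole census hypothesis beyond `K`** (the honest "`N = 1`" the energy stubs consume, fed by the
imported compactness/census stub): every closed trapped 2-sphere lying beyond `J⁻(K)` meets `J⁺(T)`, `T` the
reported collar slab — the reported hole is the only late hole of ANY size (not merely of windowed size), so no
uncounted compact mass can lens the collar cone (TRIAGE-r1-2 lensing remark; r1-1 break (3)). Sphere topology
only, as everywhere in this summit's typing. -/
def OneHoleBeyond (𝒟 : VacuumCauchyDevelopment D) (K T : Set 𝒟.carrier) : Prop :=
  ∀ [𝒟.metric.HasLeviCivita], ∀ f : Metric.sphere (0 : E3) 1 → 𝒟.carrier,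
    𝒟.metric.IsTrappedSurface (𝓡 2) 𝒟.timeOrientation f →
    Disjoint (range f) (𝒟.metric.causalPast 𝒟.timeOrientation K) →
    (range f ∩ 𝒟.metric.causalFuture 𝒟.timeOrientation T).Nonempty

/-- **Pinned cone foliation** of the cut cone `∂J⁺(C)` anchored at the sphere `S₀`: every leaf lies on the
cone, the leaf at parameter `0` IS `S₀` (anchoring — kills the free choice of initial section), the foliation is
doubly convex and of CONSTANT MASS ASPECT (the gauge in which the Hawking flux density is pointwise `≥ 0`,
`NullHypersurface.hawkingFluxDensity_nonneg`; it forbids the round→boost drift `m_H = M⟨f²⟩^{1/2}⟨f⁻¹⟩ → γM` of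
TRIAGE r1-1/r1-2/r1-3), carries the Hawking flux identity, and recedes (`|S_s| → ∞`). -/
def IsPinnedConeFoliation (𝒟 : VacuumCauchyDevelopment D) (C S₀ : Set 𝒟.carrier)
    (𝒩 : 𝒟.metric.NullHypersurface 𝒟.timeOrientation) : Prop :=
  (∀ s, range (𝒩.sec s) ⊆ frontier (𝒟.metric.causalFuture 𝒟.timeOrientation C)) ∧
  range (𝒩.sec 0) = S₀ ∧ 𝒩.IsDoublyConvex ∧ 𝒩.IsConstantMassAspect ∧ 𝒩.HasHawkingFlux ∧
  Tendsto 𝒩.area atTop (𝓝 ⊤)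

end Development

/-- **(F′) Far-cone tightness, pinned** — the idea's first lemma re-typed per TRIAGE-r1-1/2/3 (the stub
`stub_farConeTightnessPinned` of the far-share line against the restated crux). For every window `m₀`, order
`k ≥ 2`, flatness profile `prof → 0` and `ε > 0` there are a radius `R`, a collar tolerance `δ > 0` and a compact
`K` such that: in every MGHD of admissible data with complete `𝓘⁺`, for every LATE single thick collar of
windowed label `(M, a)`, `(δ, k)`-close to boosted Kerr, with slab inside a leaf `S` carrying an honest flat end
of profile `prof`, probe point in the slab, the reported hole the only late hole (`OneHoleBeyond`), and for THE
pinned constant-mass-aspect foliation `𝒩` of the collar cone anchored at the outer collar sphere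
`Φ({t* = 0, r = 3M})` with Hawking masses converging to `m` (its own limit: an own cut energy of the collar core,
rest-type to `O(δ)` because the anchor is rest-round): beyond area radius `R` the foliation gains at most `ε`,
`m − m_H(S_s) ≤ ε`. Informal support: inward energy through far late cones = backscatter of recent radiation +
primordial far-field radiation + static Coulomb/shear offsets (`‖σ‖²/R`, bounded through `prof`), all `→ 0`
uniformly in lateness; linear level = uniform smallness of the incoming `rᵖ` flux (arXiv:0910.4957). -/
def FarConeTightnessPinned : Prop :=
  ∀ (X : Type) [TopologicalSpace X] [ChartedSpace E3 X] [IsManifold (𝓡 3) ∞ X] [T2Space X]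
    [SecondCountableTopology X] [ConnectedSpace X], ∀ D ∈ admissibleVacuumData X,
    ∀ 𝒟 : VacuumCauchyDevelopment D, 𝒟.IsMaximal →
      Summit.FinalStateConjecture.HasCompleteNullInfinity 𝒟.toCauchyDevelopment →
      ∀ (m₀ : ℝ) (k : ℕ) (prof : ℝ → ℝ≥0∞) (ε : ℝ), 0 < m₀ → 2 ≤ k →
        Tendsto prof atTop (𝓝 0) → 0 < ε →
        ∃ (R : ℝ) (δ : ℝ≥0∞) (K : Set 𝒟.carrier), 0 < δ ∧ IsCompact K ∧
          ∀ (M a : ℝ) (S : Set 𝒟.carrier) (p : 𝒟.carrier) (mo : lorentzGroup × E4)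
            (B : ModelBackground) (Φ : B.domain → 𝒟.carrier)
            (𝒩 : 𝒟.metric.NullHypersurface 𝒟.timeOrientation) (m : ℝ),
            m₀ ≤ M → M ≤ m₀⁻¹ → |a| ≤ M →
            IsThickCollarChartR 𝒟.toSpacetime k δ (3 * M) M a mo B Φ →
            Φ '' B.truncTimeSlab (3 * M) 0 ⊆ S →
            p ∈ Φ '' B.truncTimeSlab (3 * M) 0 →
            Disjoint (𝒟.metric.causalFuture 𝒟.timeOrientation S)
              (𝒟.metric.causalPast 𝒟.timeOrientation K) →
            HasHonestFlatEnd 𝒟 k S prof →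
            OneHoleBeyond 𝒟 K (Φ '' B.truncTimeSlab (3 * M) 0) →
            IsPinnedConeFoliation 𝒟 (Φ '' B.truncTimeSlab (3 * M) 0)
              (Φ '' {x | B.time x.1 = 0 ∧ B.radius x.1 = 3 * M}) 𝒩 →
            Tendsto 𝒩.hawkingMass atTop (𝓝 m) →
            ∀ s, R ≤ 𝒩.areaRadius s → m - 𝒩.hawkingMass s ≤ ε

/-- **Near/far glue** of the far-share line (the readout with the dark remainder split as annulus + far
tail): an annulus bound `m_H(S_R) ≤ M + ε` (stub N′), a far-tail bound `m − m_H(S_R) ≤ ε` (stub F′) and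
`2ε ≤ γ` give the restated crux's own-energy clause `m ≤ M + γ`. [folklore] -/
theorem ownEnergy_le_of_near_far {m mR M ε γ : ℝ} (hnear : mR ≤ M + ε) (hfar : m - mR ≤ ε)
    (hγ : 2 * ε ≤ γ) : m ≤ M + γ := by
  linarith

/-- The far tail of a pinned foliation is nonnegative once the Hawking mass is monotone along it (flux
identity + pointwise nonnegative density): `m_H(S_s) ≤ m` for the limit `m`. Recorded in the abstract form
the line uses (monotone real function with a limit at `+∞`). [folklore] -/
theorem le_limit_of_monotone {f : ℝ → ℝ} {m : ℝ} (hf : Monotone f)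
    (hm : Tendsto f atTop (𝓝 m)) (s : ℝ) : f s ≤ m :=
  hf.ge_of_tendsto hm s

end Summit.FinalStateConjecture.FinalStateConjecture.Cruxes.GapExhaustion.OmegaLimitGapReadout

end
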